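import Literature.NumberTheory.EllipticCurves.BSDRankZeroDensityProofs
import Literature.NumberTheory.EllipticCurves.IwasawaLeadingTermProofs
import HarnessLib

/-!
# Track U2, route A (cell `bsd-uniform`, seat u2-p1): the KERNEL of the direct transport through
# the `2`-adic control theorem — equal `2`-Selmer orders carry rank and `Ш[2] = 0` across

HONEST FRAMING (cell `bsd-uniform`, HOME run/shared/lean/pub/bsd-uniform/, verbatim in every file of
the seat): this file is PURE ALGEBRA over the tree's descent exact sequence and the Cassels–Tate
pairing (a named fact of the tree, taken as a hypothesis). It proves NO statement about any
particular curve, asserts no Literature fact, books nothing and moves no census number; no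
per-curve certificate is counted as a uniform theorem. It is the ⟨R: assembly⟩ step of the
«a_q-odd combination at 2» that route A owns (b2b p2/idea-2 T4-PROOF.md v1.9b §6, Theorem B′,
first paragraph of its proof): once the PRINTED control theorem (Mazur–Rubin, Invent. Math. 181
(2010), Cor. 3.4 (ii): `d₂(E^F/K) = d₂(E/K)`) has delivered `#Sel₂(E^{(d)}/ℚ) = #Sel₂(E/ℚ)`, and
the Heegner half of the combination (or Gross–Zagier–Kolyvagin) has delivered the finiteness of
`Ш(E^{(d)}/ℚ)[2^∞]`, the base data `E(ℚ)[2] = 0`, `Ш(E/ℚ)[2] = 0`, `rank E(ℚ) ≤ 1` force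
`rank E^{(d)}(ℚ) = rank E(ℚ)` and `Ш(E^{(d)}/ℚ)[2^∞] = 0`. The two curves enter only through these
numerical invariants, so the theorems are stated for two arbitrary elliptic `V, W / ℚ`
(`V` = the twist, `W` = the base); the residue of route A (the reduction types at which the control
theorem is not available in print) lives in the assembly file, not here.

## Contents (all THEOREMS; no `def`, no named fact introduced)

* `natCard_selmerGroup_two_eq` — `#Sel₂ = 2^{rank} · #E(ℚ)[2] · #Ш[2]` (the tree's
  `natCard_selmerGroup_eq`, Silverman X.4.2, with `Ш[2]` written as the `2`-torsion of `Ш`).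
* `primaryComponent_eq_bot_of_torsionBy_eq_bot` — `Ш[p] = 0 ⇒ Ш[p^∞] = 0` (any abelian group).
* `rank_eq_zero_and_sha_two_eq_bot_of_card_selmerGroup_two_eq_one` — `#Sel₂(V) = 1 ⇒ rank V = 0`,
  `V(ℚ)[2] = 0`, `Ш(V)[2^∞] = 0` (no Cassels–Tate, no finiteness input: the rank-`0` base case).
* `mordellWeilRank_eq_and_sha_two_eq_bot_of_card_selmerGroup_eq` — THE KERNEL: Cassels–Tate
  (`exists_casselsTate_pairing`, hypothesis) + `#Sel₂(V) = #Sel₂(W)` + `V(ℚ)[2] = W(ℚ)[2] = 0` +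
  `Ш(W)[2] = 0` + `rank W ≤ 1` + `Ш(V)[2^∞]` finite ⇒ `rank V = rank W ∧ Ш(V)[2^∞] = 0`.
* `…_of_rank_le` — the same with the finiteness input replaced by `rank W ≤ rank V` (a point of
  infinite order on the twist) and no bound on `rank W`, for completeness.

Proof idea (Dokchitser, *Notes on the parity conjecture* §2, as proved in the tree:
`exists_selmerRank_eq_add`): `d₂(V) = dim V(ℚ)[2] + corank Sel_{2^∞}(V) + 2m`, and
`corank Sel_{2^∞} = rank + corank Ш[2^∞]` (`selmerCorank_eq_mordellWeilRank_add_holds`); with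
`d₂(V) = d₂(W) = rank W ≤ 1` everything is forced.

References: Silverman AEC X.4.2 [SilvermanAEC2009]; Milne ADT I.6.13(a) / Silverman X.4.14
(Cassels–Tate) via the tree fact `exists_casselsTate_pairing`; T. Dokchitser, Notes on the parity
conjecture §2 [Dokchitser2013ParityNotes]; Mazur–Rubin 2010 Cor. 3.4 (ii) [MazurRubin2010] (the
consumer's input, not used in this file).
-/

noncomputable section

open scoped Classical AddSubgroup

open WeierstrassCurve Literature.Algebra.Module Literature.NumberTheory.EllipticCurves

namespace Summit.BirchSwinnertonDyer.Uniform.U2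

universe u

/-! ## §1 Two group-theoretic lemmas -/

section Groups

variable {A : Type u} [AddCommGroup A]

/-- In an abelian group, if the `p`-torsion is trivial then so is the `p`-primary component:
`A[p] = 0 ⇒ A[p^∞] = 0` (induction on the exponent: `p^{n+1} x = 0` puts `p^n x` in `A[p]`).
[folklore] -/
theorem primaryComponent_eq_bot_of_torsionBy_eq_bot (p : ℕ) [Fact p.Prime]
    (h : A[(p : ℤ)] = ⊥) : AddCommGroup.primaryComponent A p = ⊥ := by
  have key : ∀ n : ℕ, ∀ x : A, p ^ n • x = 0 → x = 0 := by
    intro n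
    induction n with
    | zero => intro x hx; simpa using hx
    | succ n ih =>
      intro x hx
      have hp : p • (p ^ n • x) = 0 := by
        rw [← mul_smul, ← pow_succ']
        exact hx
      have hmem : p ^ n • x ∈ A[(p : ℤ)] := by
        refine (Submodule.mem_torsionBy_iff _ _).mpr ?_
        change (p : ℤ) • (p ^ n • x) = 0
        rw [natCast_zsmul]
        exact hp
      rw [h, AddSubgroup.mem_bot] at hmem
      exact ih x hmem
  rw [eq_bot_iff]
  intro x hx
  obtain ⟨n, hn⟩ := (AddCommGroup.mem_primaryComponent).mp hx
  rw [AddSubgroup.mem_bot]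
  exact key n x hn

/-- A subgroup of order `1` is trivial. [folklore] -/
theorem addSubgroup_eq_bot_of_natCard_eq_one (H : AddSubgroup A)
    (h : Nat.card H = 1) : H = ⊥ := by
  have := (Nat.card_eq_one_iff_unique.mp h).1
  exact H.eq_bot_of_subsingleton

end Groups

/-! ## §2 The descent count at `2` -/

section Descent

variable (W : WeierstrassCurve ℚ) [W.IsElliptic]

/-- **`#Sel₂(E/ℚ) = 2^{rank E(ℚ)} · #E(ℚ)[2] · #Ш(E/ℚ)[2]`** (Silverman AEC X.4.2, the tree's
`natCard_selmerGroup_eq` at `n = 2`, with the factor `#(Ш ⊓ H¹(ℚ,E)[2])` rewritten as the order of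
the `2`-torsion subgroup of `Ш`). [cite: SilvermanAEC2009, Thm. X.4.2] -/
theorem natCard_selmerGroup_two_eq :
    Nat.card (W.selmerGroup 2) =
      2 ^ W.mordellWeilRank * Nat.card (W.toAffine.Point[(2 : ℤ)]) *
        Nat.card ((W.sha)[(2 : ℤ)]) := by
  have h := W.natCard_selmerGroup_eq (n := 2) two_ne_zero
  simp only [Nat.cast_ofNat] at h
  rw [natCard_torsionBy_addSubgroup W.sha (2 : ℤ)]
  convert h

/-- **Rank-zero base case, no Cassels–Tate and no finiteness input needed**: if `#Sel₂(V/ℚ) = 1`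
then `rank V(ℚ) = 0`, `V(ℚ)[2] = 0` and `Ш(V/ℚ)[2^∞] = 0` (the Kummer injection
`V(ℚ)/2V(ℚ) ↪ Sel₂` and the surjection `Sel₂ ↠ Ш[2]`). [cite: SilvermanAEC2009, Thm. X.4.2] -/
theorem rank_eq_zero_and_sha_two_eq_bot_of_card_selmerGroup_two_eq_one
    (V : WeierstrassCurve ℚ) [V.IsElliptic] (h : Nat.card (V.selmerGroup 2) = 1) :
    V.mordellWeilRank = 0 ∧ V.toAffine.Point[(2 : ℤ)] = ⊥ ∧
      AddCommGroup.primaryComponent V.sha 2 = ⊥ := by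
  haveI : Fact (2 : ℕ).Prime := ⟨Nat.prime_two⟩
  have hcount := (natCard_selmerGroup_two_eq V).symm.trans h
  -- `2^r · #V(ℚ)[2] · #Ш[2] = 1`: every factor is `1`
  have hsha : Nat.card ((V.sha)[(2 : ℤ)]) = 1 := Nat.eq_one_of_mul_eq_one_left hcount
  have h12 : 2 ^ V.mordellWeilRank * Nat.card (V.toAffine.Point[(2 : ℤ)]) = 1 :=
    Nat.eq_one_of_mul_eq_one_right hcount
  have htors : Nat.card (V.toAffine.Point[(2 : ℤ)]) = 1 := Nat.eq_one_of_mul_eq_one_left h12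
  have hpow : 2 ^ V.mordellWeilRank = 1 := Nat.eq_one_of_mul_eq_one_right h12
  have hr : V.mordellWeilRank = 0 :=
    Nat.pow_right_injective (le_refl 2) (hpow.trans (pow_zero 2).symm)
  exact ⟨hr, addSubgroup_eq_bot_of_natCard_eq_one _ htors,
    primaryComponent_eq_bot_of_torsionBy_eq_bot 2 (addSubgroup_eq_bot_of_natCard_eq_one _ hsha)⟩

end Descent

/-! ## §3 The kernel: equal `2`-Selmer orders transport rank and `Ш[2] = 0` -/

section Kernel

variable (V W : WeierstrassCurve ℚ) [V.IsElliptic] [W.IsElliptic]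

/-- **THE KERNEL OF ROUTE A.** Let `V, W / ℚ` be elliptic curves with `V(ℚ)[2] = W(ℚ)[2] = 0`,
`#Sel₂(V/ℚ) = #Sel₂(W/ℚ)` (the output of the printed control theorem, Mazur–Rubin 2010
Cor. 3.4 (ii), for `V = E^{(d)}`, `W = E`), `Ш(W/ℚ)[2] = 0`, `rank W(ℚ) ≤ 1`, and `Ш(V/ℚ)[2^∞]`
finite (Gross–Zagier–Kolyvagin once `r_an(V) ≤ 1`, e.g. from the Heegner half of the a_q-odd
combination). Granting the Cassels–Tate pairing on `Ш` (tree fact `exists_casselsTate_pairing`,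
hypothesis `hCT`): `rank V(ℚ) = rank W(ℚ)` and `Ш(V/ℚ)[2^∞] = 0`. Proof: `d₂(V) = rank W ≤ 1`;
`d₂(V) = corank Sel_{2^∞}(V) + 2m = rank V + 2m` (`exists_selmerRank_eq_add`, finiteness), so
`m = 0`, the ranks agree, and the descent count leaves `#Ш(V)[2] = 1`.
[cite: Dokchitser2013ParityNotes, §2 (first display)] [cite: SilvermanAEC2009, Thm. X.4.2 and X.4.14] -/
theorem mordellWeilRank_eq_and_sha_two_eq_bot_of_card_selmerGroup_eq
    (hCT : exists_casselsTate_pairing (K := ℚ))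
    (hV2 : V.toAffine.Point[(2 : ℤ)] = ⊥) (hW2 : W.toAffine.Point[(2 : ℤ)] = ⊥)
    (hWsha : (W.sha)[(2 : ℤ)] = ⊥) (hWr : W.mordellWeilRank ≤ 1)
    (hVfin : Finite (AddCommGroup.primaryComponent V.sha 2))
    (hctrl : Nat.card (V.selmerGroup 2) = Nat.card (W.selmerGroup 2)) :
    V.mordellWeilRank = W.mordellWeilRank ∧ AddCommGroup.primaryComponent V.sha 2 = ⊥ := by
  haveI : Fact (2 : ℕ).Prime := ⟨Nat.prime_two⟩
  have hW : Nat.card (W.selmerGroup 2) = 2 ^ W.mordellWeilRank := by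
    rw [natCard_selmerGroup_two_eq W, hW2, hWsha, AddSubgroup.card_bot, AddSubgroup.card_bot,
      mul_one, mul_one]
  have hVs : Nat.card (V.selmerGroup 2) = 2 ^ W.mordellWeilRank := hctrl.trans hW
  have hVt : Nat.card (V.toAffine.Point[((2 : ℕ) : ℤ)]) = 2 ^ 0 := by
    rw [Nat.cast_ofNat, hV2, AddSubgroup.card_bot, pow_zero]
  obtain ⟨m, hm⟩ := exists_selmerRank_eq_add hCT V 2 W.mordellWeilRank 0 hVs (by convert hVt)
  have hcor : V.selmerCorank 2 = V.mordellWeilRank := by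
    rw [V.selmerCorank_eq_mordellWeilRank_add_holds 2,
      (finite_primaryComponent_sha_iff_shaCorank_eq_zero V 2).1 hVfin, add_zero]
  rw [hcor] at hm
  have hr : V.mordellWeilRank = W.mordellWeilRank := by omega
  refine ⟨hr, primaryComponent_eq_bot_of_torsionBy_eq_bot 2 ?_⟩
  have hcount := natCard_selmerGroup_two_eq V
  rw [hVs, hV2, AddSubgroup.card_bot, mul_one, hr] at hcount
  have hpos : 0 < 2 ^ W.mordellWeilRank := by positivity
  have h1 : Nat.card ((V.sha)[(2 : ℤ)]) = 1 :=
    (Nat.eq_of_mul_eq_mul_left hpos ((mul_one _).trans hcount)).symm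
  exact addSubgroup_eq_bot_of_natCard_eq_one _ h1

/-- **Variant with a point of infinite order instead of finiteness.** Same as the kernel, but the
finiteness of `Ш(V/ℚ)[2^∞]` is replaced by `rank W(ℚ) ≤ rank V(ℚ)` (e.g. a known point of
infinite order on the twist when `rank W = 1`), and NO bound on `rank W` is needed; then again
`rank V = rank W` and `Ш(V/ℚ)[2^∞] = 0` — here the finiteness of `Ш(V)[2^∞]` is a CONCLUSION
(`corank Ш[2^∞] = 0` and `Ш[2] = 0`). [cite: Dokchitser2013ParityNotes, §2 (first display)] [cite: SilvermanAEC2009, Thm. X.4.2 and X.4.14] -/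
theorem mordellWeilRank_eq_and_sha_two_eq_bot_of_card_selmerGroup_eq_of_rank_le
    (hCT : exists_casselsTate_pairing (K := ℚ))
    (hV2 : V.toAffine.Point[(2 : ℤ)] = ⊥) (hW2 : W.toAffine.Point[(2 : ℤ)] = ⊥)
    (hWsha : (W.sha)[(2 : ℤ)] = ⊥) (hVr : W.mordellWeilRank ≤ V.mordellWeilRank)
    (hctrl : Nat.card (V.selmerGroup 2) = Nat.card (W.selmerGroup 2)) :
    V.mordellWeilRank = W.mordellWeilRank ∧ AddCommGroup.primaryComponent V.sha 2 = ⊥ := by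
  haveI : Fact (2 : ℕ).Prime := ⟨Nat.prime_two⟩
  have hW : Nat.card (W.selmerGroup 2) = 2 ^ W.mordellWeilRank := by
    rw [natCard_selmerGroup_two_eq W, hW2, hWsha, AddSubgroup.card_bot, AddSubgroup.card_bot,
      mul_one, mul_one]
  have hVs : Nat.card (V.selmerGroup 2) = 2 ^ W.mordellWeilRank := hctrl.trans hW
  have hVt : Nat.card (V.toAffine.Point[((2 : ℕ) : ℤ)]) = 2 ^ 0 := by
    rw [Nat.cast_ofNat, hV2, AddSubgroup.card_bot, pow_zero]
  obtain ⟨m, hm⟩ := exists_selmerRank_eq_add hCT V 2 W.mordellWeilRank 0 hVs (by convert hVt)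
  have hcor : V.selmerCorank 2 = V.mordellWeilRank + V.shaCorank 2 :=
    V.selmerCorank_eq_mordellWeilRank_add_holds 2
  rw [hcor] at hm
  have hr : V.mordellWeilRank = W.mordellWeilRank := by omega
  refine ⟨hr, primaryComponent_eq_bot_of_torsionBy_eq_bot 2 ?_⟩
  have hcount := natCard_selmerGroup_two_eq V
  rw [hVs, hV2, AddSubgroup.card_bot, mul_one, hr] at hcount
  have hpos : 0 < 2 ^ W.mordellWeilRank := by positivity
  have h1 : Nat.card ((V.sha)[(2 : ℤ)]) = 1 :=
    (Nat.eq_of_mul_eq_mul_left hpos ((mul_one _).trans hcount)).symm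
  exact addSubgroup_eq_bot_of_natCard_eq_one _ h1

/-- **Corollary (finiteness as output in the rank-bounded variant).** Under the hypotheses of the
previous theorem `Ш(V/ℚ)[2^∞]` is finite (it is trivial). [folklore] -/
theorem finite_primaryComponent_sha_two_of_card_selmerGroup_eq_of_rank_le
    (hCT : exists_casselsTate_pairing (K := ℚ))
    (hV2 : V.toAffine.Point[(2 : ℤ)] = ⊥) (hW2 : W.toAffine.Point[(2 : ℤ)] = ⊥)
    (hWsha : (W.sha)[(2 : ℤ)] = ⊥) (hVr : W.mordellWeilRank ≤ V.mordellWeilRank)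
    (hctrl : Nat.card (V.selmerGroup 2) = Nat.card (W.selmerGroup 2)) :
    Finite (AddCommGroup.primaryComponent V.sha 2) := by
  rw [(mordellWeilRank_eq_and_sha_two_eq_bot_of_card_selmerGroup_eq_of_rank_le V W hCT hV2 hW2
    hWsha hVr hctrl).2]
  infer_instance

end Kernel

end Summit.BirchSwinnertonDyer.Uniform.U2

end
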